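import Literature.NumberTheory.Rogawski1990.LocalTransferSaturationNonsplit       -- ★ F4b (this seat): class map `π`, `finCharpolyTwo_coeff_eq`, saturation
import Literature.NumberTheory.Automorphic.UnitaryGroupRankOneClassRealisation    -- ★ F4c-1 (this seat): admissible classes of `U(J₂)(K)` are classes of semisimple elements
import HarnessLib

/-!
# The class map of `H_v = U(Φ₂)_v × U(Φ₁)_v` at a non-split place: its image lies in the CLOSED admissible set, and every admissible class is the
# class of a SEMISIMPLE `ε_H` (regular semisimple or scalar `U(Φ₂)`-part) — realisation on the CM carrier (Rogawski 1990 §3.1; Langlands–Shelstad 1990 §2.2)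

Topic `NumberTheory/Rogawski1990`; namespace `Literature.NumberTheory.Rogawski1990`.  THEOREMS ONLY (no definition, no instance, no notation, no named
fact, no `sorry`).  Cell `pub/hodgecm-mathlib` (D-0151), crux H413 = stmt-HodgeConjecture-24833, F0∕P3a road «D-N6-ns», line «N6nsGerm», stub `stub_N6nsGlue`
SATURATION HALF (LEAD F0P3a-plan (g9) T8-55 → B-p08 (g26)); census item «realisation (n1) on the CM carrier».  HONEST LABEL: HC_CM is proved only modulo
the 2 remaining named inputs (hLiu418, h413) until rung 0 closes; this file proves no letter.

THE MATHEMATICS.  `v` non-split, `w` the place above it, `ev = ` evaluation at `w` (`∏_{w′∣v} L_{w′} → L_w`, a continuous ring ISOMORPHISM here), `σ_w` the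
involution of `L_w`.  A triple `(c₀, c₁, u) ∈ (∏ L_{w′})³` is ADMISSIBLE when, read at `w`, `σc₀·c₀ = 1`, `σc₁·c₀ = c₁`, `σu·u = 1`.  (1) The admissible set
is CLOSED (`isClosed_admissibleH`).  (2) The class `π(γ_H) = (coeff₀ χ_g, coeff₁ χ_g, u) = (det g, −tr g, u)` of every `γ_H ∈ H_v` is admissible
(`classMapH_admissible`; ★ `sigma_det_mul_det_of_mem`, ★ `sigma_trace_mul_det_of_mem` read through the one-place model ★ `localNonsplitEquiv`).  (3) Every
admissible triple is the class of some `ε_H = (A, b)` with `A` REGULAR SEMISIMPLE or SCALAR (`exists_semisimple_classMapH_eq`; ★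
`exists_mem_trace_det_eq_semisimple_of_admissible` at `L_w`, pulled back along `localNonsplitEquiv`).  Hence the closure of the set of classes of `G`-regular
elements consists of classes of semisimple elements — the realisation half of «saturation».

## References
* [Rogawski1990] J. D. Rogawski, *Automorphic Representations of Unitary Groups in Three Variables*, Ann. of Math. Stud. 123 (1990), §3.1 p. 19, §4.9 p. 54.
* [LanglandsShelstad1990Descent] R. P. Langlands, D. Shelstad, *Descent for transfer factors*, Progr. Math. 87 (1990), §2.2 p. 11.
* [PlatonovRapinchuk1994] V. Platonov, A. Rapinchuk, *Algebraic Groups and Number Theory* (1994), §5.1.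
-/

set_option autoImplicit false

noncomputable section

open NumberField IsDedekindDomain Matrix Polynomial Set Filter Topology
open scoped MatrixGroups Valued

namespace Literature.NumberTheory.Rogawski1990

open Literature.NumberTheory.Automorphic
open Literature.NumberTheory.GelbartRogawski1991.UnitaryDualPair (imagUnit complexConj_imagUnit imagUnit_ne_zero)

variable (L : Type) [Field L] [NumberField L] [IsCMField L] (v : HeightOneSpectrum (𝓞 ↥(maximalRealSubfield L)))
  (w : UnitaryGroup.PlacesOver L v) (hw : IsCMField.complexConj L • w.1 = w.1)

/-! ## §1 The field `L_w`: involution, `2 ≠ 0`, the unit `ν₀`; `Φ₁` at `w` -/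

omit [IsCMField L] in
/-- `Φ₁` read over `L_w` is the `1 × 1` matrix `(1)`. [cite: Rogawski1990, §4.9 p. 54] -/
theorem placeForm_one_eq : UnitaryGroup.placeForm (Matrix.of fun i j : Fin 1 => if i.val + j.val + 1 = 1 then (1 : L) else 0) w.1 = !![(1 : w.1.adicCompletion L)] := by
  ext i j
  fin_cases i; fin_cases j
  simp [UnitaryGroup.placeForm, Matrix.map_apply]

omit [IsCMField L] in
/-- The `(0,0)` entry of `Φ₁` read over `L_w` is `1`. [cite: Rogawski1990, §4.9 p. 54] -/
theorem placeForm_one_apply_zero : UnitaryGroup.placeForm (Matrix.of fun i j : Fin 1 => if i.val + j.val + 1 = 1 then (1 : L) else 0) w.1 0 0 = 1 := by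
  simp [UnitaryGroup.placeForm, Matrix.map_apply]

include hw in
/-- The standing facts about `L_w` used below: `σ_w` is an involution, `2 ≠ 0`, and `ν₀ = √(−Δ)` is a non-zero anti-invariant. [cite: Rogawski1990, §3.1 p. 19] -/
theorem localField_facts :
    (∀ x, galAdicCompletionMap (L := L) (IsCMField.complexConj L) hw (galAdicCompletionMap (L := L) (IsCMField.complexConj L) hw x) = x) ∧ (2 : w.1.adicCompletion L) ≠ 0 ∧
      galAdicCompletionMap (L := L) (IsCMField.complexConj L) hw (algebraMap L (w.1.adicCompletion L) (imagUnit L)) = -(algebraMap L (w.1.adicCompletion L) (imagUnit L)) ∧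
      algebraMap L (w.1.adicCompletion L) (imagUnit L) ≠ 0 := by
  have hinj : Function.Injective (algebraMap L (w.1.adicCompletion L)) := (algebraMap L (w.1.adicCompletion L)).injective
  haveI : CharZero (w.1.adicCompletion L) := charZero_of_injective_algebraMap hinj
  refine ⟨UnitaryGroup.galAdicCompletionMap_galAdicCompletionMap_of_smul_eq (IsCMField.complexConj L) w (IsCMField.complexConj_ne_one L) hw,
    two_ne_zero, ?_, ?_⟩
  · have h := galAdicCompletionMap_coe (L := L) (IsCMField.complexConj L) hw (imagUnit L)
    rw [show ((IsCMField.complexConj L) • imagUnit L : L) = -imagUnit L from complexConj_imagUnit L] at h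
    change galAdicCompletionMap (L := L) (IsCMField.complexConj L) hw ((imagUnit L : L) : w.1.adicCompletion L) =
      -(((imagUnit L : L)) : w.1.adicCompletion L)
    rw [h]
    change algebraMap L (w.1.adicCompletion L) (-imagUnit L) = -(algebraMap L (w.1.adicCompletion L) (imagUnit L))
    exact map_neg _ _
  · have h := hinj.ne (imagUnit_ne_zero L)
    rwa [map_zero] at h

/-! ## §2 The admissible set is closed and contains every class -/

include hw in
/-- **The admissible set is CLOSED** in `(∏_{w′∣v} L_{w′})³`. [cite: LanglandsShelstad1990Descent, §2.2 p. 11] -/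
theorem isClosed_admissibleH :
    IsClosed {q : UnitaryGroup.LocalRing L v × UnitaryGroup.LocalRing L v × UnitaryGroup.LocalRing L v | galAdicCompletionMap (L := L) (IsCMField.complexConj L) hw (Pi.evalRingHom (fun w' : UnitaryGroup.PlacesOver L v => w'.1.adicCompletion L) w q.1) * Pi.evalRingHom (fun w' : UnitaryGroup.PlacesOver L v => w'.1.adicCompletion L) w q.1 = 1 ∧ galAdicCompletionMap (L := L) (IsCMField.complexConj L) hw (Pi.evalRingHom (fun w' : UnitaryGroup.PlacesOver L v => w'.1.adicCompletion L) w q.2.1) * Pi.evalRingHom (fun w' : UnitaryGroup.PlacesOver L v => w'.1.adicCompletion L) w q.1 = Pi.evalRingHom (fun w' : UnitaryGroup.PlacesOver L v => w'.1.adicCompletion L) w q.2.1 ∧ galAdicCompletionMap (L := L) (IsCMField.complexConj L) hw (Pi.evalRingHom (fun w' : UnitaryGroup.PlacesOver L v => w'.1.adicCompletion L) w q.2.2) * Pi.evalRingHom (fun w' : UnitaryGroup.PlacesOver L v => w'.1.adicCompletion L) w q.2.2 = 1} := by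
  have hev : Continuous (Pi.evalRingHom (fun w' : UnitaryGroup.PlacesOver L v => w'.1.adicCompletion L) w) := continuous_apply w
  have hσ : Continuous (galAdicCompletionMap (L := L) (IsCMField.complexConj L) hw) := continuous_galAdicCompletionMap L (IsCMField.complexConj L) hw
  simp only [Set.setOf_and]
  exact (isClosed_eq ((hσ.comp (hev.comp continuous_fst)).mul (hev.comp continuous_fst)) continuous_const).inter
    ((isClosed_eq ((hσ.comp (hev.comp continuous_snd.fst)).mul (hev.comp continuous_fst)) (hev.comp continuous_snd.fst)).inter
      (isClosed_eq ((hσ.comp (hev.comp continuous_snd.snd)).mul (hev.comp continuous_snd.snd)) continuous_const))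

/-- **Every class is admissible**: for `γ_H = (g, u) ∈ H_v`, read at `w`, `σ(det g)·det g = 1`, `σ(coeff₁ χ_g)·det g = coeff₁ χ_g`, `σu·u = 1`.
[cite: Rogawski1990, §3.1 p. 19] [cite: PlatonovRapinchuk1994, §5.1] -/
theorem classMapH_admissible (γ : (UnitaryGroup.cmDatum L 2 (Matrix.of fun i j : Fin 2 => if i.val + j.val + 1 = 2 then (1 : L) else 0)).Local v × (UnitaryGroup.cmDatum L 1 (Matrix.of fun i j : Fin 1 => if i.val + j.val + 1 = 1 then (1 : L) else 0)).Local v) :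
    galAdicCompletionMap (L := L) (IsCMField.complexConj L) hw (Pi.evalRingHom (fun w' : UnitaryGroup.PlacesOver L v => w'.1.adicCompletion L) w ((finCharpolyTwo L v γ).coeff 0)) * Pi.evalRingHom (fun w' : UnitaryGroup.PlacesOver L v => w'.1.adicCompletion L) w ((finCharpolyTwo L v γ).coeff 0) = 1 ∧
      galAdicCompletionMap (L := L) (IsCMField.complexConj L) hw (Pi.evalRingHom (fun w' : UnitaryGroup.PlacesOver L v => w'.1.adicCompletion L) w ((finCharpolyTwo L v γ).coeff 1)) * Pi.evalRingHom (fun w' : UnitaryGroup.PlacesOver L v => w'.1.adicCompletion L) w ((finCharpolyTwo L v γ).coeff 0) = Pi.evalRingHom (fun w' : UnitaryGroup.PlacesOver L v => w'.1.adicCompletion L) w ((finCharpolyTwo L v γ).coeff 1) ∧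
      galAdicCompletionMap (L := L) (IsCMField.complexConj L) hw (Pi.evalRingHom (fun w' : UnitaryGroup.PlacesOver L v => w'.1.adicCompletion L) w (finGammaTwo L v γ)) * Pi.evalRingHom (fun w' : UnitaryGroup.PlacesOver L v => w'.1.adicCompletion L) w (finGammaTwo L v γ) = 1 := by
  rw [(finCharpolyTwo_coeff_eq L v γ).1, (finCharpolyTwo_coeff_eq L v γ).2]
  -- the `U(Φ₂)` slot through the one-place model
  set e₂ := UnitaryGroup.localNonsplitEquiv (IsCMField.complexConj L) (Matrix.of fun i j : Fin 2 => if i.val + j.val + 1 = 2 then (1 : L) else 0) (IsCMField.complexConj_ne_one L) w hw with he₂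
  have hmem₂ : ((e₂ γ.1 : ↥(unitaryGroupOfForm (galAdicCompletionMap (L := L) (IsCMField.complexConj L) hw) (UnitaryGroup.placeForm (Matrix.of fun i j : Fin 2 => if i.val + j.val + 1 = 2 then (1 : L) else 0) w.1))) : GL (Fin 2) (w.1.adicCompletion L)) ∈
      unitaryGroupOfForm (galAdicCompletionMap (L := L) (IsCMField.complexConj L) hw) !![(0 : w.1.adicCompletion L), 1; 1, 0] := by
    rw [← UnitaryGroup.placeForm_antidiagTwo_eq L v w]; exact (e₂ γ.1).2
  have hval₂ : ((e₂ γ.1 : ↥(unitaryGroupOfForm (galAdicCompletionMap (L := L) (IsCMField.complexConj L) hw) (UnitaryGroup.placeForm (Matrix.of fun i j : Fin 2 => if i.val + j.val + 1 = 2 then (1 : L) else 0) w.1))) : GL (Fin 2) (w.1.adicCompletion L)).val =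
      ((γ.1.val : GL (Fin 2) (UnitaryGroup.LocalRing L v))).val.map (Pi.evalRingHom (fun w' : UnitaryGroup.PlacesOver L v => w'.1.adicCompletion L) w) := rfl
  have hdet : ((e₂ γ.1 : ↥(unitaryGroupOfForm (galAdicCompletionMap (L := L) (IsCMField.complexConj L) hw) (UnitaryGroup.placeForm (Matrix.of fun i j : Fin 2 => if i.val + j.val + 1 = 2 then (1 : L) else 0) w.1))) : GL (Fin 2) (w.1.adicCompletion L)).val.det =
      Pi.evalRingHom (fun w' : UnitaryGroup.PlacesOver L v => w'.1.adicCompletion L) w ((γ.1.val : GL (Fin 2) (UnitaryGroup.LocalRing L v))).val.det := by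
    rw [hval₂, ← RingHom.mapMatrix_apply, ← RingHom.map_det]
  have htr : ((e₂ γ.1 : ↥(unitaryGroupOfForm (galAdicCompletionMap (L := L) (IsCMField.complexConj L) hw) (UnitaryGroup.placeForm (Matrix.of fun i j : Fin 2 => if i.val + j.val + 1 = 2 then (1 : L) else 0) w.1))) : GL (Fin 2) (w.1.adicCompletion L)).val.trace =
      Pi.evalRingHom (fun w' : UnitaryGroup.PlacesOver L v => w'.1.adicCompletion L) w ((γ.1.val : GL (Fin 2) (UnitaryGroup.LocalRing L v))).val.trace := by
    rw [hval₂, Matrix.trace_fin_two, Matrix.trace_fin_two, Matrix.map_apply, Matrix.map_apply, map_add]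
  have h1 := UnitaryGroup.sigma_det_mul_det_of_mem hmem₂
  have h2 := UnitaryGroup.sigma_trace_mul_det_of_mem hmem₂
  rw [hdet] at h1
  rw [hdet, htr] at h2
  -- the `U(Φ₁)` slot
  set e₁ := UnitaryGroup.localNonsplitEquiv (IsCMField.complexConj L) (Matrix.of fun i j : Fin 1 => if i.val + j.val + 1 = 1 then (1 : L) else 0) (IsCMField.complexConj_ne_one L) w hw with he₁
  have hmem₁ := (e₁ γ.2).2
  rw [mem_unitaryGroupOfForm_iff] at hmem₁
  have h00 := congr_fun (congr_fun hmem₁ 0) 0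
  have hval₁ : ∀ i j : Fin 1, ((e₁ γ.2 : ↥(unitaryGroupOfForm (galAdicCompletionMap (L := L) (IsCMField.complexConj L) hw) (UnitaryGroup.placeForm (Matrix.of fun i j : Fin 1 => if i.val + j.val + 1 = 1 then (1 : L) else 0) w.1))) : GL (Fin 1) (w.1.adicCompletion L)).val i j =
      Pi.evalRingHom (fun w' : UnitaryGroup.PlacesOver L v => w'.1.adicCompletion L) w (((γ.2.val : GL (Fin 1) (UnitaryGroup.LocalRing L v))).val i j) := fun i j => rfl
  simp only [Matrix.mul_apply, Fin.sum_univ_one, Matrix.transpose_apply, Matrix.map_apply, hval₁] at h00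
  simp only [Matrix.of_apply, Fin.val_zero, zero_add, if_true, map_one, mul_one] at h00
  refine ⟨h1, ?_, ?_⟩
  · rw [map_neg, map_neg, neg_mul, h2]
  · unfold finGammaTwo
    exact h00

/-! ## §3 Realisation: every admissible triple is the class of a semisimple `ε_H` -/

/-- **REALISATION ON THE CM CARRIER.**  At a non-split `v`, every ADMISSIBLE triple `(c₀, c₁, u)` is the class `π(ε_H)` of some `ε_H = (A, b) ∈ H_v` whose
`U(Φ₂)`-part is REGULAR SEMISIMPLE (`χ_A` separable) or SCALAR (`A = a·1`). [cite: Rogawski1990, §3.1 p. 19] [cite: LanglandsShelstad1990Descent, §2.2 p. 11]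
[cite: PlatonovRapinchuk1994, §5.1] -/
theorem exists_semisimple_classMapH_eq (c₀ c₁ u : UnitaryGroup.LocalRing L v) (h₀ : galAdicCompletionMap (L := L) (IsCMField.complexConj L) hw (Pi.evalRingHom (fun w' : UnitaryGroup.PlacesOver L v => w'.1.adicCompletion L) w c₀) * Pi.evalRingHom (fun w' : UnitaryGroup.PlacesOver L v => w'.1.adicCompletion L) w c₀ = 1) (h₁ : galAdicCompletionMap (L := L) (IsCMField.complexConj L) hw (Pi.evalRingHom (fun w' : UnitaryGroup.PlacesOver L v => w'.1.adicCompletion L) w c₁) * Pi.evalRingHom (fun w' : UnitaryGroup.PlacesOver L v => w'.1.adicCompletion L) w c₀ = Pi.evalRingHom (fun w' : UnitaryGroup.PlacesOver L v => w'.1.adicCompletion L) w c₁)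
    (hu : galAdicCompletionMap (L := L) (IsCMField.complexConj L) hw (Pi.evalRingHom (fun w' : UnitaryGroup.PlacesOver L v => w'.1.adicCompletion L) w u) * Pi.evalRingHom (fun w' : UnitaryGroup.PlacesOver L v => w'.1.adicCompletion L) w u = 1) :
    ∃ εH : (UnitaryGroup.cmDatum L 2 (Matrix.of fun i j : Fin 2 => if i.val + j.val + 1 = 2 then (1 : L) else 0)).Local v × (UnitaryGroup.cmDatum L 1 (Matrix.of fun i j : Fin 1 => if i.val + j.val + 1 = 1 then (1 : L) else 0)).Local v, (IsRegularElt (εH.1.val : GL (Fin 2) (UnitaryGroup.LocalRing L v)) ∨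
        ∃ a : UnitaryGroup.LocalRing L v, (εH.1.val.val : Matrix (Fin 2) (Fin 2) (UnitaryGroup.LocalRing L v)) = a • (1 : Matrix (Fin 2) (Fin 2) (UnitaryGroup.LocalRing L v))) ∧
      ((finCharpolyTwo L v εH).coeff 0, (finCharpolyTwo L v εH).coeff 1, finGammaTwo L v εH) = (c₀, c₁, u) := by
  obtain ⟨hσ, h2, hν₀, hν₀0⟩ := localField_facts L v w hw
  have hinj : Function.Injective (Pi.evalRingHom (fun w' : UnitaryGroup.PlacesOver L v => w'.1.adicCompletion L) w) := UnitaryGroup.eval_injective_of_smul_eq L v w hw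
  have hsurj : Function.Surjective (Pi.evalRingHom (fun w' : UnitaryGroup.PlacesOver L v => w'.1.adicCompletion L) w) := Function.surjective_eval w
  -- admissibility of `(t, Δ) = (−c₁(w), c₀(w))`
  have ht : galAdicCompletionMap (L := L) (IsCMField.complexConj L) hw (Pi.evalRingHom (fun w' : UnitaryGroup.PlacesOver L v => w'.1.adicCompletion L) w (-c₁)) * Pi.evalRingHom (fun w' : UnitaryGroup.PlacesOver L v => w'.1.adicCompletion L) w c₀ = Pi.evalRingHom (fun w' : UnitaryGroup.PlacesOver L v => w'.1.adicCompletion L) w (-c₁) := by rw [map_neg, map_neg, neg_mul, h₁]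
  obtain ⟨g, hgU, hgtr, hgdet, hss⟩ :=
    UnitaryGroup.exists_mem_trace_det_eq_semisimple_of_admissible hσ h2 hν₀ hν₀0 h₀ ht
  rw [← UnitaryGroup.placeForm_antidiagTwo_eq L v w] at hgU
  -- the `U(Φ₂)`-part `A = e₂⁻¹ g`
  set e₂ := UnitaryGroup.localNonsplitEquiv (IsCMField.complexConj L) (Matrix.of fun i j : Fin 2 => if i.val + j.val + 1 = 2 then (1 : L) else 0) (IsCMField.complexConj_ne_one L) w hw with he₂
  obtain ⟨A, hA_def⟩ : ∃ A : (UnitaryGroup.cmDatum L 2 (Matrix.of fun i j : Fin 2 => if i.val + j.val + 1 = 2 then (1 : L) else 0)).Local v, A = e₂.symm ⟨g, hgU⟩ := ⟨_, rfl⟩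
  have hA : ((A.val : GL (Fin 2) (UnitaryGroup.LocalRing L v))).val.map (Pi.evalRingHom (fun w' : UnitaryGroup.PlacesOver L v => w'.1.adicCompletion L) w) = g.val := by
    have h := congrArg (fun x : ↥(unitaryGroupOfForm (galAdicCompletionMap (L := L) (IsCMField.complexConj L) hw) (UnitaryGroup.placeForm (Matrix.of fun i j : Fin 2 => if i.val + j.val + 1 = 2 then (1 : L) else 0) w.1)) => ((x : GL (Fin 2) (w.1.adicCompletion L))).val)
      (e₂.apply_symm_apply ⟨g, hgU⟩)
    rw [← hA_def] at h
    exact h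
  -- the `U(Φ₁)`-part `b = e₁⁻¹ (u(w))`
  have hu' : galAdicCompletionMap (L := L) (IsCMField.complexConj L) hw (u w) * u w = 1 := hu
  have hx : u w * galAdicCompletionMap (L := L) (IsCMField.complexConj L) hw (u w) = 1 := by rw [mul_comm]; exact hu'
  have hb1 : !![Pi.evalRingHom (fun w' : UnitaryGroup.PlacesOver L v => w'.1.adicCompletion L) w u] * !![galAdicCompletionMap (L := L) (IsCMField.complexConj L) hw (Pi.evalRingHom (fun w' : UnitaryGroup.PlacesOver L v => w'.1.adicCompletion L) w u)] = 1 := Matrix.ext fun i j => by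
    fin_cases i; fin_cases j; simp [Matrix.mul_apply, hx]
  have hb2 : !![galAdicCompletionMap (L := L) (IsCMField.complexConj L) hw (Pi.evalRingHom (fun w' : UnitaryGroup.PlacesOver L v => w'.1.adicCompletion L) w u)] * !![Pi.evalRingHom (fun w' : UnitaryGroup.PlacesOver L v => w'.1.adicCompletion L) w u] = 1 := Matrix.ext fun i j => by
    fin_cases i; fin_cases j; simp [Matrix.mul_apply, hu']
  have hbU : (⟨_, _, hb1, hb2⟩ : GL (Fin 1) (w.1.adicCompletion L)) ∈ unitaryGroupOfForm (galAdicCompletionMap (L := L) (IsCMField.complexConj L) hw) (UnitaryGroup.placeForm (Matrix.of fun i j : Fin 1 => if i.val + j.val + 1 = 1 then (1 : L) else 0) w.1) := by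
    rw [mem_unitaryGroupOfForm_iff, placeForm_one_eq L v w]
    refine Matrix.ext fun i j => ?_
    fin_cases i; fin_cases j
    simp [Matrix.mul_apply, hu']
  set e₁ := UnitaryGroup.localNonsplitEquiv (IsCMField.complexConj L) (Matrix.of fun i j : Fin 1 => if i.val + j.val + 1 = 1 then (1 : L) else 0) (IsCMField.complexConj_ne_one L) w hw with he₁
  obtain ⟨B, hB_def⟩ : ∃ B : (UnitaryGroup.cmDatum L 1 (Matrix.of fun i j : Fin 1 => if i.val + j.val + 1 = 1 then (1 : L) else 0)).Local v, B = e₁.symm ⟨_, hbU⟩ := ⟨_, rfl⟩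
  have hB : ∀ i j : Fin 1, Pi.evalRingHom (fun w' : UnitaryGroup.PlacesOver L v => w'.1.adicCompletion L) w (((B.val : GL (Fin 1) (UnitaryGroup.LocalRing L v))).val i j) = !![Pi.evalRingHom (fun w' : UnitaryGroup.PlacesOver L v => w'.1.adicCompletion L) w u] i j := by
    have h := congrArg (fun x : ↥(unitaryGroupOfForm (galAdicCompletionMap (L := L) (IsCMField.complexConj L) hw) (UnitaryGroup.placeForm (Matrix.of fun i j : Fin 1 => if i.val + j.val + 1 = 1 then (1 : L) else 0) w.1)) => ((x : GL (Fin 1) (w.1.adicCompletion L))).val)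
      (e₁.apply_symm_apply ⟨_, hbU⟩)
    rw [← hB_def] at h
    intro i j
    exact congr_fun (congr_fun h i) j
  refine ⟨(A, B), ?_, ?_⟩
  · -- semisimplicity of `A`
    rcases hss with hsep | ⟨a', ha'⟩
    · left
      rw [isRegularElt_iff]
      -- `χ_A` read at `w` is `χ_g`; `ev` is a ring isomorphism
      have hχ : (((A.val : GL (Fin 2) (UnitaryGroup.LocalRing L v))).val.charpoly).map (Pi.evalRingHom (fun w' : UnitaryGroup.PlacesOver L v => w'.1.adicCompletion L) w) = g.val.charpoly := by
        rw [← Matrix.charpoly_map, hA]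
      set eR : UnitaryGroup.LocalRing L v ≃+* w.1.adicCompletion L := RingEquiv.ofBijective (Pi.evalRingHom (fun w' : UnitaryGroup.PlacesOver L v => w'.1.adicCompletion L) w) ⟨hinj, hsurj⟩ with heR
      have hback : ((A.val : GL (Fin 2) (UnitaryGroup.LocalRing L v))).val.charpoly = (g.val.charpoly).map (eR.symm : w.1.adicCompletion L →+* UnitaryGroup.LocalRing L v) := by
        rw [← hχ, Polynomial.map_map]
        have hcomp : (eR.symm : w.1.adicCompletion L →+* UnitaryGroup.LocalRing L v).comp (Pi.evalRingHom (fun w' : UnitaryGroup.PlacesOver L v => w'.1.adicCompletion L) w) = RingHom.id _ :=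
          RingHom.ext fun x => eR.symm_apply_apply x
        rw [hcomp, Polynomial.map_id]
      rw [hback]
      exact hsep.map
    · right
      have ha'_g := ha'
      obtain ⟨a, ha⟩ := hsurj a'
      refine ⟨a, ?_⟩
      have hmapinj : Function.Injective fun M : Matrix (Fin 2) (Fin 2) (UnitaryGroup.LocalRing L v) => M.map (Pi.evalRingHom (fun w' : UnitaryGroup.PlacesOver L v => w'.1.adicCompletion L) w) :=
        fun M N h => Matrix.ext fun i j => hinj (congr_fun (congr_fun h i) j)
      have ha' : a w = a' := ha
      apply hmapinj
      show ((A.val : GL (Fin 2) (UnitaryGroup.LocalRing L v))).val.map (Pi.evalRingHom (fun w' : UnitaryGroup.PlacesOver L v => w'.1.adicCompletion L) w) = (a • (1 : Matrix (Fin 2) (Fin 2) (UnitaryGroup.LocalRing L v))).map (Pi.evalRingHom (fun w' : UnitaryGroup.PlacesOver L v => w'.1.adicCompletion L) w)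
      rw [hA, ha'_g]
      refine Matrix.ext fun i j => ?_
      by_cases hij : i = j
      · subst hij; simp [ha']
      · simp [hij]
  · -- the class
    simp only [Prod.mk.injEq]
    refine ⟨hinj ?_, hinj ?_, hinj ?_⟩
    · rw [(finCharpolyTwo_coeff_eq L v (A, B)).1, RingHom.map_det, RingHom.mapMatrix_apply]
      show (((A.val : GL (Fin 2) (UnitaryGroup.LocalRing L v))).val.map (Pi.evalRingHom (fun w' : UnitaryGroup.PlacesOver L v => w'.1.adicCompletion L) w)).det = Pi.evalRingHom (fun w' : UnitaryGroup.PlacesOver L v => w'.1.adicCompletion L) w c₀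
      rw [hA, hgdet]
    · rw [(finCharpolyTwo_coeff_eq L v (A, B)).2, map_neg]
      show -(Pi.evalRingHom (fun w' : UnitaryGroup.PlacesOver L v => w'.1.adicCompletion L) w ((A.val : GL (Fin 2) (UnitaryGroup.LocalRing L v))).val.trace) = Pi.evalRingHom (fun w' : UnitaryGroup.PlacesOver L v => w'.1.adicCompletion L) w c₁
      rw [Matrix.trace_fin_two, map_add, ← Matrix.map_apply (f := (Pi.evalRingHom (fun w' : UnitaryGroup.PlacesOver L v => w'.1.adicCompletion L) w)), ← Matrix.map_apply (f := (Pi.evalRingHom (fun w' : UnitaryGroup.PlacesOver L v => w'.1.adicCompletion L) w)), hA, ← Matrix.trace_fin_two, hgtr,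
        map_neg, neg_neg]
    · show Pi.evalRingHom (fun w' : UnitaryGroup.PlacesOver L v => w'.1.adicCompletion L) w (((B.val : GL (Fin 1) (UnitaryGroup.LocalRing L v))).val 0 0) = Pi.evalRingHom (fun w' : UnitaryGroup.PlacesOver L v => w'.1.adicCompletion L) w u
      rw [hB]
      simp

end Literature.NumberTheory.Rogawski1990

end
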